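import Literature.Geometry.Lorentzian.KerrDeSitterRadialTSFormThreeHalves
import HarnessLib

/-!
# Half-integer spin `|s| = 3/2` on the real axis, III: the value of the Teukolsky–Starobinsky form at
# the cosmological horizon (outgoing branch)

HONEST LABEL. One of the two endpoint evaluations needed to turn the conservation law
`hasDerivAt_tsFormThreeHalves` (file II) into the `s = 3/2` energy identity: the LEFT LIMIT at
`r_c` of `W(r; R(r), R′(r))` on a solution that is outgoing at `𝓗⁺_c`, `R = (r_c − r)^{B(r_c)}g`
(`Re B(r_c) = 0` at a real frequency), equals `c_c·|g(r_c)|²` with the MANIFESTLY POSITIVE weight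
`c_c = (4K̃(r_c)² + Δ_r′(r_c)²/4)(4K̃(r_c)² + 9Δ_r′(r_c)²/4)`, `K̃ = ΞK`
(`tendsto_tsFormThreeHalves_rCosmo`, `tsCosmoWeightThreeHalves_pos`). This is a limit of a sum of
CONVERGENT terms (the outgoing branch is the regular one at `r_c`); the algebra behind the closed
form is the identity `p₁₁ + 2K̃·Im p₁₂ + K̃²·p₂₂ = (4K̃² + Δ′²/4)(4K̃² + 9Δ′²/4)` AT A ROOT of `Δ`
(`tsq_endpoint_regular`, generic even quartic, proved by eliminating `d₀` and `ring`). The other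
endpoint — the right limit at `r₊` on the ingoing branch `(r − r₊)^{−3/2 − B(r₊)}f`, where the
three terms of `W` diverge separately and the finite value `−ℭ_{3/2}Δ_r′(r₊)/(4β₊² + 1/4)·|f(r₊)|²`
needs the Frobenius jet of `f` — is NOT in this file, and hence neither is any statement about
radial solutions vanishing. Definitions with bodies + theorems, NO named facts.

Sources: [Costa2019] R. Teixeira da Costa, Commun. Math. Phys. 378 (2020), Proposition 2.21
(p. 17 l. 30–62): the weights `Π_j[4|ξ|² + (s − j)²]` of the half-integer energy identity at the
regular end — here `(4K̃² + Δ′²/4)(4K̃² + 9Δ′²/4) = Δ′⁴(4β² + (3/2 − 1)²)(4β² + (3/2 − 0)²)`,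
`β = K̃/Δ′`; [CasalsTeixeiradacosta2022] Definition 3.3 (outgoing at `𝓗⁺_c`) and Theorem 3.10.
-/

noncomputable section

open Complex Set Filter Topology

open scoped ComplexConjugate

namespace Literature.Geometry.Lorentzian.KerrDeSitter

/-! ### The algebraic endpoint identity at a root of `Δ` -/

/-- **Value of the spin-`3/2` form on the regular branch at a simple root of `Δ`.** At a root `r` of
the even quartic `Δ` (generic coefficients),
`p₁₁(r) + 2K̃(r)·Im p₁₂(r) + K̃(r)²·p₂₂(r) = (4K̃(r)² + Δ′(r)²/4)·(4K̃(r)² + 9Δ′(r)²/4)` — the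
combination picked out by a solution `(r_h − x)^{iK̃(r_h)/Δ′(r_h)}·g(x)` with `g(r_h) ≠ 0`; cf. the
weights `Π_j[4|ξ|² + (s − j)²]` of the half-integer energy identity.
[cite: Costa2019, Proposition 2.21] -/
theorem tsq_endpoint_regular {d₀ d₁ d₂ d₄ : ℝ} (k₀ k₂ el : ℝ) {r : ℝ}
    (h : tsqDelta d₀ d₁ d₂ d₄ r = 0) :
    tsqP11 d₀ d₁ d₂ d₄ k₀ k₂ el r + 2 * tsqK k₀ k₂ r * tsqP12im d₀ d₁ d₂ d₄ k₀ k₂ el r +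
        tsqK k₀ k₂ r ^ 2 * tsqP22 d₀ d₁ d₂ d₄ k₀ k₂ el r =
      (4 * tsqK k₀ k₂ r ^ 2 + tsqDeltaD d₁ d₂ d₄ r ^ 2 / 4) *
        (4 * tsqK k₀ k₂ r ^ 2 + 9 / 4 * tsqDeltaD d₁ d₂ d₄ r ^ 2) := by
  have hd₀ : d₀ = -(d₁ * r + d₂ * r ^ 2 + d₄ * r ^ 4) := by
    unfold tsqDelta at h
    linarith
  subst hd₀
  unfold tsqP11 tsqK tsqP12im tsqP22 tsqDeltaD
  ring

/-! ### The weight at the cosmological horizon -/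

/-- **The weight of the `s = 3/2` energy identity at `𝓗⁺_c`**:
`c_c = (4K̃(r_c)² + Δ_r′(r_c)²/4)·(4K̃(r_c)² + 9Δ_r′(r_c)²/4)`, `K̃(r_c) = Ξ·Re K(r_c)`
(`= Δ_r′(r_c)⁴(4β_c² + 1/4)(4β_c² + 9/4)`, `β_c = ΞK(r_c)/Δ_r′(r_c)`).
[cite: Costa2019, Proposition 2.21] -/
def tsCosmoWeightThreeHalves (M a Λ : ℝ) (ω : ℂ) (m : ℝ) : ℝ :=
  (4 * (xi a Λ * (radialK a ω m (rCosmo M a Λ)).re) ^ 2 + deltaDeriv M a Λ (rCosmo M a Λ) ^ 2 / 4) *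
    (4 * (xi a Λ * (radialK a ω m (rCosmo M a Λ)).re) ^ 2 +
      9 / 4 * deltaDeriv M a Λ (rCosmo M a Λ) ^ 2)

/-- The weight at `𝓗⁺_c` is strictly positive on subextremal Kerr–de Sitter (`Δ_r′(r_c) ≠ 0`), for
every frequency. [cite: Costa2019, Proposition 2.21] -/
theorem tsCosmoWeightThreeHalves_pos {M a Λ : ℝ} (hsub : IsSubextremal M a Λ) (ω : ℂ) (m : ℝ) :
    0 < tsCosmoWeightThreeHalves M a Λ ω m := by
  have hd := deltaDeriv_rCosmo_neg hsub
  have hd2 : 0 < deltaDeriv M a Λ (rCosmo M a Λ) ^ 2 := by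
    rw [sq]; exact mul_pos_of_neg_of_neg hd hd
  have hK := sq_nonneg (xi a Λ * (radialK a ω m (rCosmo M a Λ)).re)
  unfold tsCosmoWeightThreeHalves
  apply mul_pos <;> linarith

/-! ### The left limit of the form at `r_c` on the outgoing branch -/

/-- `|u^z|² = u^{2Re z}` for a positive real base (private plumbing). [folklore] -/
private theorem normSq_ofReal_cpow {u : ℝ} (hu : 0 < u) (z : ℂ) :
    normSq (((u : ℝ) : ℂ) ^ z) = u ^ (2 * z.re) := by
  rw [normSq_eq_norm_sq, norm_cpow_eq_rpow_re_of_pos hu, ← Real.rpow_natCast,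
    ← Real.rpow_mul hu.le]
  congr 1
  push_cast
  ring

/-- The derivative of a branch `S = u^z·g` on an interval where it is known to be differentiable:
`S' = z u^{z−1} u' g + u^z g'` (uniqueness of derivatives; private plumbing). [folklore] -/
private theorem deriv_eq_of_cpowBranch {U J : Set ℝ} (hU : IsOpen U) (hJ : IsOpen J) (hJU : J ⊆ U)
    {g : ℝ → ℂ} (hg : ContDiffOn ℝ ((⊤ : ℕ∞) : WithTop ℕ∞) g U)
    {u : ℝ → ℝ} {c : ℝ} (hu : ∀ x, HasDerivAt u c x) (hupos : ∀ x ∈ J, 0 < u x)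
    (z : ℂ) {S S' : ℝ → ℂ} (hS : ∀ x ∈ J, HasDerivAt S (S' x) x)
    (hSg : ∀ x ∈ J, S x = ((u x : ℝ) : ℂ) ^ z * g x) :
    ∀ x ∈ J, S' x = z * ((u x : ℝ) : ℂ) ^ (z - 1) * (c : ℂ) * g x +
      ((u x : ℝ) : ℂ) ^ z * deriv g x := by
  intro x hx
  have h0 : ((⊤ : ℕ∞) : WithTop ℕ∞) ≠ 0 := by simp
  have hgd : DifferentiableOn ℝ g U := hg.differentiableOn h0
  have hgx : HasDerivAt g (deriv g x) x :=
    ((hgd x (hJU hx)).differentiableAt (hU.mem_nhds (hJU hx))).hasDerivAt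
  have hux : HasDerivAt (fun y => ((u y : ℝ) : ℂ)) (c : ℂ) x := (hu x).ofReal_comp
  have hslit : ((u x : ℝ) : ℂ) ∈ slitPlane := ofReal_mem_slitPlane.2 (hupos x hx)
  have hpow' : HasDerivAt ((fun w : ℂ => w ^ z) ∘ fun y => ((u y : ℝ) : ℂ))
      (z * ((u x : ℝ) : ℂ) ^ (z - 1) * (c : ℂ)) x :=
    (hasStrictDerivAt_cpow_const (c := z) hslit).hasDerivAt.comp x hux
  have hpow : HasDerivAt (fun y => ((u y : ℝ) : ℂ) ^ z)
      (z * ((u x : ℝ) : ℂ) ^ (z - 1) * (c : ℂ)) x := by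
    simpa only [Function.comp_def] using hpow'
  have hprod := hpow.mul hgx
  have heq : S =ᶠ[𝓝 x] fun y => ((u y : ℝ) : ℂ) ^ z * g y :=
    Filter.eventually_of_mem (hJ.mem_nhds hx) fun y hy => hSg y hy
  exact (hS x hx).unique (hprod.congr_of_eventuallyEq heq)

/-- The branch algebra behind the endpoint evaluation (private plumbing): with `R = P·g`,
`R′ = P·H/u`, `|P|² = 1`, `D = −uσ` (`u ≠ 0` real), the form
`A|R|² + 2Re(D·(P_r + iP_i)·R·conj R′) + D²C|R′|²` equals
`A|g|² − 2Re(σ(P_r + iP_i)·g·conj H) + σ²C|H|²`. [folklore] -/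
private theorem form_branch_eq {A Pr Pi C D σ u : ℝ} {P g H R R' : ℂ} (hu : u ≠ 0)
    (hP : normSq P = 1) (hD : D = -u * σ) (hR : R = P * g) (hR' : R' = P * H / (u : ℂ)) :
    A * normSq R + 2 * ((D : ℂ) * ((Pr : ℂ) + I * (Pi : ℂ)) * R * conj R').re +
        D ^ 2 * C * normSq R' =
      A * normSq g + 2 * (-(σ : ℂ) * ((Pr : ℂ) + I * (Pi : ℂ)) * g * conj H).re +
        σ ^ 2 * C * normSq H := by
  have huc : (u : ℂ) ≠ 0 := by exact_mod_cast hu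
  subst hD hR hR'
  have h1 : normSq (P * g) = normSq g := by rw [map_mul, hP, one_mul]
  have h2 : (((-u * σ : ℝ)) : ℂ) * ((Pr : ℂ) + I * (Pi : ℂ)) * (P * g) * conj (P * H / (u : ℂ)) =
      -(σ : ℂ) * ((Pr : ℂ) + I * (Pi : ℂ)) * g * conj H * (P * conj P) := by
    simp only [map_mul, map_div₀, conj_ofReal]
    push_cast
    field_simp
  have h3 : (-u * σ) ^ 2 * C * normSq (P * H / (u : ℂ)) = σ ^ 2 * C * normSq H * normSq P := by
    rw [map_div₀, map_mul, normSq_ofReal]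
    field_simp
  rw [h1, h2, mul_conj, hP, h3, hP]
  push_cast
  ring

/-- **Limit of the spin-`3/2` form on the regular branch at a simple root (generic even quartic).**
Let `p` be a root of `Δ`, `β` real with `β·Δ′(p) = K̃(p)`, and let `R` be differentiable on
`(lo, p)` with derivative witness `R′` and of the REGULAR-branch form `R = (p − x)^{iβ}·g` on
`(p − ε, p)`, `g` smooth on `(p − ε, p + ε)`. Then
`W(x; R(x), R′(x)) → (4K̃(p)² + Δ′(p)²/4)(4K̃(p)² + 9Δ′(p)²/4)·|g(p)|²` as `x ↑ p`. Mechanism: with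
`u = p − x`, `R′ = u^{iβ}(u g′ − iβ g)/u` and `Δ = −uσ`, the form is
`p₁₁|g|² − 2Re(σp₁₂ g conj(u g′ − iβg)) + σ²p₂₂|u g′ − iβ g|²` — a sum of CONTINUOUS terms — whose
value at `p` is `(p₁₁ + 2K̃ Im p₁₂ + K̃²p₂₂)(p)|g(p)|²`; `tsq_endpoint_regular` gives the closed
form. [cite: Costa2019, Proposition 2.21] -/
theorem tendsto_tsqForm_regular {d₀ d₁ d₂ d₄ k₀ k₂ el p lo β : ℝ}
    (hΔp : tsqDelta d₀ d₁ d₂ d₄ p = 0) (hβ : β * tsqDeltaD d₁ d₂ d₄ p = tsqK k₀ k₂ p)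
    (hlo : lo < p) {R R' : ℝ → ℂ} (hR' : ∀ x ∈ Ioo lo p, HasDerivAt R (R' x) x)
    {ε : ℝ} (hε : 0 < ε) {g : ℝ → ℂ}
    (hg : ContDiffOn ℝ ((⊤ : ℕ∞) : WithTop ℕ∞) g (Ioo (p - ε) (p + ε)))
    (hRg : ∀ x ∈ Ioo (p - ε) p, R x * ((p - x : ℝ) : ℂ) ^ (-(I * (β : ℂ))) = g x) :
    Tendsto (fun x => tsqForm d₀ d₁ d₂ d₄ k₀ k₂ el x (R x) (R' x)) (𝓝[<] p)
      (𝓝 ((4 * tsqK k₀ k₂ p ^ 2 + tsqDeltaD d₁ d₂ d₄ p ^ 2 / 4) *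
        (4 * tsqK k₀ k₂ p ^ 2 + 9 / 4 * tsqDeltaD d₁ d₂ d₄ p ^ 2) * normSq (g p))) := by
  have h1top : (1 : WithTop ℕ∞) ≤ ((⊤ : ℕ∞) : WithTop ℕ∞) := by exact_mod_cast le_top
  have h0top : ((⊤ : ℕ∞) : WithTop ℕ∞) ≠ 0 := by simp
  have hwre : (I * (β : ℂ)).re = 0 := by simp
  -- `Δ = −(p − x)σ`, `σ(p) = Δ′(p)`
  obtain ⟨σ, hσ⟩ : ∃ σ : ℝ → ℝ, σ = fun x => d₁ + d₂ * (x + p) +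
      d₄ * (x ^ 3 + x ^ 2 * p + x * p ^ 2 + p ^ 3) := ⟨_, rfl⟩
  have hΔσ : ∀ x, tsqDelta d₀ d₁ d₂ d₄ x = -(p - x) * σ x := by
    intro x
    rw [hσ]
    unfold tsqDelta at hΔp ⊢
    linear_combination hΔp
  have hσp : σ p = tsqDeltaD d₁ d₂ d₄ p := by
    rw [hσ]; unfold tsqDeltaD; ring
  have hσc : Continuous σ := by rw [hσ]; fun_prop
  -- the branch representation of `R` and `R′` near `p`
  have hUo : IsOpen (Ioo (p - ε) (p + ε)) := isOpen_Ioo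
  have hpU : p ∈ Ioo (p - ε) (p + ε) := ⟨by linarith, by linarith⟩
  have hb : max (p - ε) lo < p := max_lt (by linarith) hlo
  have hJU : Ioo (max (p - ε) lo) p ⊆ Ioo (p - ε) (p + ε) := fun x hx =>
    ⟨lt_of_le_of_lt (le_max_left _ _) hx.1, by linarith [hx.2]⟩
  have hJD : Ioo (max (p - ε) lo) p ⊆ Ioo lo p := fun x hx =>
    ⟨lt_of_le_of_lt (le_max_right _ _) hx.1, hx.2⟩
  have hgd : DifferentiableOn ℝ g (Ioo (p - ε) (p + ε)) := hg.differentiableOn h0top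
  have hgc : ContinuousAt g p :=
    (hgd.continuousOn.continuousWithinAt hpU).continuousAt (hUo.mem_nhds hpU)
  have hg'c : ContinuousAt (deriv g) p :=
    ((hg.continuousOn_deriv_of_isOpen hUo h1top).continuousWithinAt hpU).continuousAt
      (hUo.mem_nhds hpU)
  have hRJ : ∀ x ∈ Ioo (max (p - ε) lo) p, R x = ((p - x : ℝ) : ℂ) ^ (I * (β : ℂ)) * g x := by
    intro x hx
    have hx0 : (0 : ℝ) < p - x := by linarith [hx.2]
    have hne : ((p - x : ℝ) : ℂ) ≠ 0 := by exact_mod_cast hx0.ne'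
    have h := hRg x ⟨lt_of_le_of_lt (le_max_left _ _) hx.1, hx.2⟩
    have hpow : ((p - x : ℝ) : ℂ) ^ (I * (β : ℂ)) ≠ 0 := by
      rw [Ne, cpow_eq_zero_iff, not_and_or]; exact Or.inl hne
    rw [cpow_neg] at h
    rw [← h, mul_comm (R x) _, ← mul_assoc, mul_inv_cancel₀ hpow, one_mul]
  have hR'J := deriv_eq_of_cpowBranch hUo isOpen_Ioo hJU hg (u := fun x => p - x) (c := -1)
    (fun x => (hasDerivAt_id' x).const_sub _) (fun x hx => by simp only [sub_pos]; exact hx.2)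
    (I * (β : ℂ)) (S := R) (S' := R') (fun x hx => hR' x (hJD hx)) hRJ
  -- the regular factor of `R′`: `R′ = u^{iβ}·H/u`, `H = u g′ − iβ g`
  obtain ⟨H, hH⟩ : ∃ H : ℝ → ℂ, H = fun x => ((p - x : ℝ) : ℂ) * deriv g x - I * (β : ℂ) * g x :=
    ⟨_, rfl⟩
  have hR'H : ∀ x ∈ Ioo (max (p - ε) lo) p,
      R' x = ((p - x : ℝ) : ℂ) ^ (I * (β : ℂ)) * H x / ((p - x : ℝ) : ℂ) := by
    intro x hx
    have hx0 : (0 : ℝ) < p - x := by linarith [hx.2]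
    have hne : ((p - x : ℝ) : ℂ) ≠ 0 := by exact_mod_cast hx0.ne'
    have hne' : (p : ℂ) - (x : ℂ) ≠ 0 := by
      have h := hne
      push_cast at h
      exact h
    have e1 : ((p - x : ℝ) : ℂ) ^ (I * (β : ℂ) - 1) =
        ((p - x : ℝ) : ℂ) ^ (I * (β : ℂ)) / ((p - x : ℝ) : ℂ) := by
      rw [cpow_sub _ _ hne, cpow_one]
    rw [hR'J x hx, e1, hH]
    push_cast
    field_simp
    ring
  -- the form on the branch: a sum of terms continuous at `p`
  have hWJ : ∀ x ∈ Ioo (max (p - ε) lo) p, tsqForm d₀ d₁ d₂ d₄ k₀ k₂ el x (R x) (R' x) =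
      tsqP11 d₀ d₁ d₂ d₄ k₀ k₂ el x * normSq (g x) +
        2 * (-(σ x : ℂ) * ((tsqP12re d₀ d₁ d₂ d₄ k₀ k₂ el x : ℂ) +
          I * (tsqP12im d₀ d₁ d₂ d₄ k₀ k₂ el x : ℂ)) * g x * conj (H x)).re +
        σ x ^ 2 * tsqP22 d₀ d₁ d₂ d₄ k₀ k₂ el x * normSq (H x) := by
    intro x hx
    have hx0 : (0 : ℝ) < p - x := by linarith [hx.2]
    have hnpow : normSq (((p - x : ℝ) : ℂ) ^ (I * (β : ℂ))) = 1 := by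
      rw [normSq_ofReal_cpow hx0, hwre, mul_zero, Real.rpow_zero]
    unfold tsqForm
    exact form_branch_eq hx0.ne' hnpow (hΔσ x) (hRJ x hx) (hR'H x hx)
  have hHc : ContinuousAt H p := by
    have h1 : ContinuousAt (fun x : ℝ => ((p - x : ℝ) : ℂ)) p := by fun_prop
    rw [hH]
    exact (h1.mul hg'c).sub (continuousAt_const.mul hgc)
  have hHp : H p = -(I * (β : ℂ) * g p) := by simp [hH]
  have hmodc : ContinuousAt (fun x => tsqP11 d₀ d₁ d₂ d₄ k₀ k₂ el x * normSq (g x) +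
      2 * (-(σ x : ℂ) * ((tsqP12re d₀ d₁ d₂ d₄ k₀ k₂ el x : ℂ) +
        I * (tsqP12im d₀ d₁ d₂ d₄ k₀ k₂ el x : ℂ)) * g x * conj (H x)).re +
      σ x ^ 2 * tsqP22 d₀ d₁ d₂ d₄ k₀ k₂ el x * normSq (H x)) p := by
    have hAc : ContinuousAt (fun x => tsqP11 d₀ d₁ d₂ d₄ k₀ k₂ el x) p :=
      (hasDerivAt_tsqP11 d₀ d₁ d₂ d₄ k₀ k₂ el p).continuousAt
    have hPrC : ContinuousAt (fun x => ((tsqP12re d₀ d₁ d₂ d₄ k₀ k₂ el x : ℝ) : ℂ)) p :=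
      (hasDerivAt_tsqP12re d₀ d₁ d₂ d₄ k₀ k₂ el p).continuousAt.ofReal
    have hPiC : ContinuousAt (fun x => ((tsqP12im d₀ d₁ d₂ d₄ k₀ k₂ el x : ℝ) : ℂ)) p :=
      (hasDerivAt_tsqP12im d₀ d₁ d₂ d₄ k₀ k₂ el p).continuousAt.ofReal
    have hCc : ContinuousAt (fun x => tsqP22 d₀ d₁ d₂ d₄ k₀ k₂ el x) p :=
      (hasDerivAt_tsqP22 d₀ d₁ d₂ d₄ k₀ k₂ el p).continuousAt
    have hσC : ContinuousAt (fun x => ((σ x : ℝ) : ℂ)) p := hσc.continuousAt.ofReal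
    have hHb : ContinuousAt (fun x => conj (H x)) p := continuous_conj.continuousAt.comp hHc
    have hmid : ContinuousAt (fun x => -(σ x : ℂ) * ((tsqP12re d₀ d₁ d₂ d₄ k₀ k₂ el x : ℂ) +
        I * (tsqP12im d₀ d₁ d₂ d₄ k₀ k₂ el x : ℂ)) * g x * conj (H x)) p :=
      ((hσC.neg.mul (hPrC.add (continuousAt_const.mul hPiC))).mul hgc).mul hHb
    have t1 := hAc.mul (continuous_normSq.continuousAt.comp hgc)
    have t2 : ContinuousAt (fun x => 2 * (-(σ x : ℂ) * ((tsqP12re d₀ d₁ d₂ d₄ k₀ k₂ el x : ℂ) +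
        I * (tsqP12im d₀ d₁ d₂ d₄ k₀ k₂ el x : ℂ)) * g x * conj (H x)).re) p :=
      continuousAt_const.mul (continuous_re.continuousAt.comp hmid)
    have t3 := ((hσc.continuousAt.pow 2).mul hCc).mul (continuous_normSq.continuousAt.comp hHc)
    exact (t1.add t2).add t3
  -- the value at `p`
  have hval : tsqP11 d₀ d₁ d₂ d₄ k₀ k₂ el p * normSq (g p) +
      2 * (-(σ p : ℂ) * ((tsqP12re d₀ d₁ d₂ d₄ k₀ k₂ el p : ℂ) +
        I * (tsqP12im d₀ d₁ d₂ d₄ k₀ k₂ el p : ℂ)) * g p * conj (H p)).re +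
      σ p ^ 2 * tsqP22 d₀ d₁ d₂ d₄ k₀ k₂ el p * normSq (H p) =
      (4 * tsqK k₀ k₂ p ^ 2 + tsqDeltaD d₁ d₂ d₄ p ^ 2 / 4) *
        (4 * tsqK k₀ k₂ p ^ 2 + 9 / 4 * tsqDeltaD d₁ d₂ d₄ p ^ 2) * normSq (g p) := by
    rw [← tsq_endpoint_regular k₀ k₂ el hΔp, ← hβ, hHp, hσp]
    simp only [mul_re, mul_im, neg_re, neg_im, add_re, add_im, ofReal_re, ofReal_im, I_re, I_im,
      conj_re, conj_im, normSq_apply]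
    ring
  -- conclusion
  have hlim := hmodc.tendsto
  rw [hval] at hlim
  refine ((hlim.mono_left nhdsWithin_le_nhds).congr' ?_)
  filter_upwards [Ioo_mem_nhdsLT hb] with x hx
  exact (hWJ x hx).symm

/-- **Left limit of the `s = 3/2` Teukolsky–Starobinsky form at the cosmological horizon of
Kerr–de Sitter.** On subextremal Kerr–de Sitter with `Im ω = 0`, let `R` be differentiable on
`(r₊, r_c)` with derivative witness `R′` and outgoing at `𝓗⁺_c`: `R·(r_c − r)^{−B(r_c)} = g` on
`(r_c − ε, r_c)` with `g` smooth on `(r_c − ε, r_c + ε)` (`IsOutgoingAtCosmoHorizon`, unpacked).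
Then `W(r; R(r), R′(r)) → c_c·|g(r_c)|²` as `r ↑ r_c`, `c_c = tsCosmoWeightThreeHalves > 0`
(`tendsto_tsqForm_regular` at `p = r_c`, `β = ΞK(r_c)/Δ_r′(r_c)`, `B(r_c) = iβ`). The separation
constant enters `W` but not the limit. [cite: Costa2019, Proposition 2.21;
CasalsTeixeiradacosta2022, Definition 3.3] -/
theorem tendsto_tsFormThreeHalves_rCosmo {M a Λ : ℝ} {ω : ℂ} {m : ℝ} (lam : ℂ)
    (hsub : IsSubextremal M a Λ) (hω : ω.im = 0) {R R' : ℝ → ℂ}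
    (hR' : ∀ r ∈ Ioo (rPlus M a Λ) (rCosmo M a Λ), HasDerivAt R (R' r) r)
    {ε : ℝ} (hε : 0 < ε) {g : ℝ → ℂ}
    (hg : ContDiffOn ℝ ((⊤ : ℕ∞) : WithTop ℕ∞) g (Ioo (rCosmo M a Λ - ε) (rCosmo M a Λ + ε)))
    (hRg : ∀ r ∈ Ioo (rCosmo M a Λ - ε) (rCosmo M a Λ),
      R r * ((rCosmo M a Λ - r : ℝ) : ℂ) ^ (-horizonB M a Λ ω m (rCosmo M a Λ)) = g r) :
    Tendsto (fun x => tsFormThreeHalves M a Λ ω m lam x (R x) (R' x)) (𝓝[<] rCosmo M a Λ)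
      (𝓝 (tsCosmoWeightThreeHalves M a Λ ω m * normSq (g (rCosmo M a Λ)))) := by
  have hd2 := deltaDeriv_rCosmo_neg hsub
  obtain ⟨-, -, -, h12, -, hΔ2, -, -, -⟩ := hsub
  obtain ⟨Kc, hKc⟩ : ∃ Kc : ℝ, Kc = (radialK a ω m (rCosmo M a Λ)).re := ⟨_, rfl⟩
  have hKreal : radialK a ω m (rCosmo M a Λ) = (Kc : ℂ) := by
    rw [hKc]; exact Complex.ext (by simp) (by simp [im_radialK_of_real a hω m (rCosmo M a Λ)])
  have hD' : (deltaDeriv M a Λ (rCosmo M a Λ) : ℂ) ≠ 0 := by exact_mod_cast hd2.ne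
  -- `B(r_c) = iβ`, `β = ΞK(r_c)/Δ′(r_c)`
  have hwK : horizonB M a Λ ω m (rCosmo M a Λ) =
      I * ((xi a Λ * Kc / deltaDeriv M a Λ (rCosmo M a Λ) : ℝ) : ℂ) := by
    simp only [horizonB]
    rw [hKreal]
    push_cast
    field_simp
  have hΔp : tsqDelta (a ^ 2) (-(2 * M)) (1 - Λ / 3 * a ^ 2) (-(Λ / 3)) (rCosmo M a Λ) = 0 := by
    rw [← delta_eq_tsqDelta]; exact hΔ2
  have hKt : tsqK (kdsK0 a Λ ω m) (kdsK2 a Λ ω) (rCosmo M a Λ) = xi a Λ * Kc := by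
    rw [hKc]
    simp only [tsqK, kdsK0, kdsK2, radialK, sub_re, mul_re, ofReal_re, ofReal_im, mul_zero,
      sub_zero]
    ring
  have hDt : tsqDeltaD (-(2 * M)) (1 - Λ / 3 * a ^ 2) (-(Λ / 3)) (rCosmo M a Λ) =
      deltaDeriv M a Λ (rCosmo M a Λ) := (deltaDeriv_eq_tsqDeltaD M a Λ _).symm
  have hβ : xi a Λ * Kc / deltaDeriv M a Λ (rCosmo M a Λ) *
      tsqDeltaD (-(2 * M)) (1 - Λ / 3 * a ^ 2) (-(Λ / 3)) (rCosmo M a Λ) =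
      tsqK (kdsK0 a Λ ω m) (kdsK2 a Λ ω) (rCosmo M a Λ) := by
    rw [hDt, hKt, div_mul_cancel₀ _ hd2.ne]
  have hRg' : ∀ r ∈ Ioo (rCosmo M a Λ - ε) (rCosmo M a Λ), R r * ((rCosmo M a Λ - r : ℝ) : ℂ) ^
      (-(I * ((xi a Λ * Kc / deltaDeriv M a Λ (rCosmo M a Λ) : ℝ) : ℂ))) = g r := by
    intro r hr
    rw [← hwK]
    exact hRg r hr
  have h := tendsto_tsqForm_regular (el := kdsEl a Λ lam) hΔp hβ h12 hR' hε hg hRg'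
  rw [hKt, hDt, hKc] at h
  exact h

end Literature.Geometry.Lorentzian.KerrDeSitter

end
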